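import Summits.CriticalPhenomena.PercolationContinuityZ3.Theorems.Transplant.SkelNegBParamsSlotsSU
import Summits.CriticalPhenomena.PercolationContinuityZ3.Theorems.Transplant.SkelNegBParamsSchedA
import HarnessLib

/-!
# N1 params, chain of record `NegB`, part SlotsSU-A — the (ζ′) twin of parts SlotsS/SlotsST/SlotsSU at `A := Aof κ = 20·K`: THE φ-DIAMETER OF A RIM HABITAT
# **`mRA mx := max (2·(n_L + ℓ_L + 3|h_L| + 1)·(50·fcellsA.rmax + 1)) mx`** (the φ-extent of a fine extent `50·rmax` by `φ_extent_fineA_at`'s `|Δφ′| ≤ 2(…)(r+1)` — the (ζ′)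
# constant `2` replaces today's `80`), and THE FIBRE BLOCK OF RECORD OF THE (ζ′) CHAIN **`NegB.SUA (ex mx : GSlot) : SSlot := ⟨max fcellsA.rmax (cOffA+1), 1, 0, ψπ, 0, ex, Rex (mRA mx) q⟩`**
# with every schedule-side binder of the three residues BY NAME (`hgap20_UA hgapc_UA hgapR_UA hgapL_UA ex_le_Lp_UA three_le_E₀_UA hsch_UA Rex_mono_UA hR₁_UA hRex_UA hR₁_UA_η`,
# `E₀_SUA_eq`, `Lp_SUA_eq`), THE ROOT RADII of `schedOfA … (Sv …)` for any block (`hRQ_RA hRB_RA hRQ'_RA hRM_RA`; `Rπ … Sv q := E₀ − 1` is part SlotsSU's, block-generic, reused)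
# and the `Rπ`-floors at `SUA` (`ex_le_RπA`, `fat_le_RπA`, `Rex_fat_le_RπA_sub`) (stmt-g16 2026-08-22; NEG-SCOPE §B.19 (ζ′))
Reused unchanged: `GSlot`, `SSlot`, `ψπ`/`ψπ_eq`, `Rex`/`Rex_mono`/`hR₁_at`/`hRex_at` (part Excess; cell-free), `Rπ`, `twelve_le_E₀`, `Rπ_succ`, `le_Rπ_of`, `le_Rπ_of_reachK`.
builds on p205010 (kernel theorem, internal audit signed; external expert review pending) — nothing in this file uses p205010; NOTHING is claimed about the node
`SamePDropOfSkeletonNeg₁` (OPEN).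
Lane `prim-bschramm-*`, seat `prim-bschramm-stmt` (gen 16); helper file (`--supports stmt-CriticalPhenomena-4575 --as helper`); ledger HOME/prim-bschramm-stmt/NEG-PARAMS.md.
* §1 **`mRA`**, `mRA_ge`, **`fine_diam_le_mRA`**; §2 **`SUA`**, `SUA_fields`, `SUA_rmax_ge`, the gap/`L′`/`E₀`/excess facts `…_UA`, **`E₀_SUA_eq`**, `Lp_SUA_eq`;
* §3 **`hRQ_RA hRB_RA hRQ'_RA hRM_RA`** (any `Sv`); §4 `ex_le_RπA`, **`fat_le_RπA`**, **`Rex_fat_le_RπA_sub`**, `SRex_fat_le_RπA_sub`.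
[cite: KozmaNitzan2024, §4 Theorem 6 (pp. 25–31), p. 28 ((32) at the root); Lemma 12 (p. 24)] [cite: MartineauTassion2017, §4.3]
-/

noncomputable section

open scoped Classical

namespace Summit.CriticalPhenomena.PercolationContinuityZ3.Theorems.Transplant

namespace PlanarSkeletonNeg

namespace NegB

open MeasureTheory Literature.Probability.Percolation Literature.Probability.LatticeModels SimpleGraph
open Literature.Barriers.CriticalPhenomena (graphBall)
open SkelConc (Consts)
open BoxProdZ2 (ConcRadiiG Erad Frad nQ)
open Skelφ (oriφ trφ)
open Skelφ.StepI (DataN OutO)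
open Skel (excess)
open Neg

/-! ## §1 The φ-diameter of a rim habitat of the (ζ′) cells -/

section Values

variable (κ : Consts) {V : Type} [DecidableEq V] [Countable V] {G : SimpleGraph V} [G.LocallyFinite] (Φ : PlanarSkeletonNeg G) (t : V)
  (p : unitInterval) (D : DataN V) (g f mx : ℕ)

/-- **The φ-diameter of a rim habitat of the (ζ′) cells** (residual slot `mx`): `mRA := max (2·(n_L + ℓ_L + 3|h_L| + 1)·(50·fcellsA.rmax + 1)) mx`. [this work] -/
def mRA : ℕ := max (2 * (nL κ Φ t p D g f + ℓL κ Φ t p D g f + 3 * (hL κ Φ t p D g f).natAbs + 1) * (50 * (fcellsA κ Φ t p D g f).rmax + 1)) mx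

/-- The two floors inside `mRA`. [folklore] -/
theorem mRA_ge : 2 * (nL κ Φ t p D g f + ℓL κ Φ t p D g f + 3 * (hL κ Φ t p D g f).natAbs + 1) * (50 * (fcellsA κ Φ t p D g f).rmax + 1) ≤ mRA κ Φ t p D g f mx ∧
    mx ≤ mRA κ Φ t p D g f mx := ⟨le_max_left _ _, le_max_right _ _⟩

/-- **FINE DIAMETER ⇒ φ-DIAMETER** for the (ζ′) cells: fine coordinates (map slot `φ′`) within `50·fcellsA.rmax` on both axes give `φ′ d − φ′ d' ∈ box 2 (mRA mx)`. [folklore] -/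
theorem fine_diam_le_mRA (hN : EqNumL κ Φ t p D g f) {φ' : V → Site 2} {d d' : V}
    (h : fineA κ Φ t p D g f φ' d - fineA κ Φ t p D g f φ' d' ∈ box 2 (50 * (fcellsA κ Φ t p D g f).rmax)) : φ' d - φ' d' ∈ box 2 (mRA κ Φ t p D g f mx) := by
  rw [mem_box] at h ⊢
  intro i
  have hρ : ∀ j, |fineA κ Φ t p D g f φ' d j - fineA κ Φ t p D g f φ' d' j| ≤ ((50 * (fcellsA κ Φ t p D g f).rmax : ℕ) : ℤ) := fun j => by
    have hj := h j
    rw [Pi.sub_apply] at hj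
    exact abs_le.2 hj
  have hK := (φ_extent_fineA_at κ Φ t p D g f hN (Nat.cast_nonneg _) hρ i).2
  have hm : ((2 * (nL κ Φ t p D g f + ℓL κ Φ t p D g f + 3 * (hL κ Φ t p D g f).natAbs + 1) * (50 * (fcellsA κ Φ t p D g f).rmax + 1) : ℕ) : ℤ) ≤
      (mRA κ Φ t p D g f mx : ℤ) := by
    exact_mod_cast (mRA_ge κ Φ t p D g f mx).1
  have h2 : 2 * ((nL κ Φ t p D g f : ℤ) + ℓL κ Φ t p D g f + 3 * |hL κ Φ t p D g f| + 1) * (((50 * (fcellsA κ Φ t p D g f).rmax : ℕ) : ℤ) + 1) =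
      ((2 * (nL κ Φ t p D g f + ℓL κ Φ t p D g f + 3 * (hL κ Φ t p D g f).natAbs + 1) * (50 * (fcellsA κ Φ t p D g f).rmax + 1) : ℕ) : ℤ) := by
    push_cast; ring
  rw [Pi.sub_apply]
  exact abs_le.1 (hK.trans (h2 ▸ hm))

end Values

/-! ## §2 The fibre block of record of the (ζ′) chain -/

/-- **THE FIBRE BLOCK OF RECORD OF THE (ζ′) CHAIN**: `⟨max fcellsA.rmax (cOffA+1), 1, 0, ψπ, 0, ex κ Φ t p D g f, NegB.Rex (mRA … (mx …)) q⟩`.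
[cite: KozmaNitzan2024, §4 Theorem 6 (pp. 25–31): the order of constants] -/
def SUA (ex mx : GSlot) : SSlot := fun κ _ _ _ _ _ Φ t p D g f q =>
  ⟨max (fcellsA κ Φ t p D g f).rmax (cOffA κ Φ t p D g f + 1), 1, 0, ψπ Φ p D, 0, ex κ Φ t p D g f, Rex κ Φ (mRA κ Φ t p D g f (mx κ Φ t p D g f)) q⟩

section Facts

variable (κ : Consts) {V : Type} [DecidableEq V] [Countable V] {G : SimpleGraph V} [G.LocallyFinite] (Φ : PlanarSkeletonNeg G) (t : V)
  (p : unitInterval) (D : DataN V) (g f : ℕ) (ex mx : GSlot) (q : unitInterval)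

/-- The fields of `SUA` (all `rfl`). [folklore] -/
theorem SUA_fields : (SUA ex mx κ Φ t p D g f q).rmax = max (fcellsA κ Φ t p D g f).rmax (cOffA κ Φ t p D g f + 1) ∧ (SUA ex mx κ Φ t p D g f q).u = 1 ∧
    (SUA ex mx κ Φ t p D g f q).M = 0 ∧ (SUA ex mx κ Φ t p D g f q).ψM = ψπ Φ p D ∧ (SUA ex mx κ Φ t p D g f q).ψtop = 0 ∧ (SUA ex mx κ Φ t p D g f q).reachK = ex κ Φ t p D g f ∧
    (SUA ex mx κ Φ t p D g f q).Rex = Rex κ Φ (mRA κ Φ t p D g f (mx κ Φ t p D g f)) q :=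
  ⟨rfl, rfl, rfl, rfl, rfl, rfl, rfl⟩

/-- `fcellsA.rmax ≤ rmax` and `cOffA + 1 ≤ rmax`. [folklore] -/
theorem SUA_rmax_ge : (fcellsA κ Φ t p D g f).rmax ≤ (SUA ex mx κ Φ t p D g f q).rmax ∧ cOffA κ Φ t p D g f + 1 ≤ (SUA ex mx κ Φ t p D g f q).rmax :=
  ⟨le_max_left _ _, le_max_right _ _⟩

/-- **`20·fcellsA.rmax ≤ gap ρ`**. [folklore] -/
theorem hgap20_UA (ρ : ℕ) : 20 * (fcellsA κ Φ t p D g f).rmax ≤ Skelφ.Prm.gap (SUA ex mx κ Φ t p D g f q) ρ :=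
  le_trans (Nat.mul_le_mul_left _ (SUA_rmax_ge κ Φ t p D g f ex mx q).1) (Skelφ.Prm.twenty_rmax_le_gap _ ρ)

/-- **`cOffA ≤ gap ρ`**. [folklore] -/
theorem hgapc_UA (ρ : ℕ) : cOffA κ Φ t p D g f ≤ Skelφ.Prm.gap (SUA ex mx κ Φ t p D g f q) ρ := by
  have h1 := (SUA_rmax_ge κ Φ t p D g f ex mx q).2
  have h2 := Skelφ.Prm.dG_le_gap (SUA ex mx κ Φ t p D g f q) ρ
  exact le_trans (le_trans (le_trans (Nat.le_succ _) h1) (Nat.le_mul_of_pos_left _ (by norm_num))) h2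

/-- **`cOffA + 2L′ + Rex ρ + 2 ≤ gap ρ`**. [folklore] -/
theorem hgapR_UA (ρ : ℕ) : cOffA κ Φ t p D g f + 2 * Skelφ.Prm.Lp (SUA ex mx κ Φ t p D g f q) + Rex κ Φ (mRA κ Φ t p D g f (mx κ Φ t p D g f)) q ρ + 2 ≤
    Skelφ.Prm.gap (SUA ex mx κ Φ t p D g f q) ρ := by
  rw [Skelφ.Prm.gap_eq]
  have h1 : cOffA κ Φ t p D g f + 1 ≤ (SUA ex mx κ Φ t p D g f q).rmax := (SUA_rmax_ge κ Φ t p D g f ex mx q).2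
  have h2 : Rex κ Φ (mRA κ Φ t p D g f (mx κ Φ t p D g f)) q ρ ≤ (SUA ex mx κ Φ t p D g f q).Rex (ρ + 1) := Rex_mono κ Φ _ q (Nat.le_succ ρ)
  generalize (SUA ex mx κ Φ t p D g f q).rmax = R at h1 ⊢
  generalize (SUA ex mx κ Φ t p D g f q).Rex (ρ + 1) = X at h2 ⊢
  generalize Skelφ.Prm.Lp (SUA ex mx κ Φ t p D g f q) = L
  omega

/-- `L′ ≤ gap ρ`. [folklore] -/
theorem hgapL_UA (ρ : ℕ) : Skelφ.Prm.Lp (SUA ex mx κ Φ t p D g f q) ≤ Skelφ.Prm.gap (SUA ex mx κ Φ t p D g f q) ρ := Skelφ.Prm.hgapL _ ρ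

/-- **`ex ≤ L′ ≤ E₀`**. [folklore] -/
theorem ex_le_Lp_UA : ex κ Φ t p D g f ≤ Skelφ.Prm.Lp (SUA ex mx κ Φ t p D g f q) ∧ Skelφ.Prm.Lp (SUA ex mx κ Φ t p D g f q) ≤ Skelφ.Prm.E₀ (SUA ex mx κ Φ t p D g f q) := by
  refine ⟨?_, Skelφ.Prm.Lp_le_E₀ _⟩
  have h := Skelφ.Prm.reachK_le_Lp (SUA ex mx κ Φ t p D g f q)
  exact h

/-- `3 ≤ E₀`, indeed `45·fcellsA.rmax ≤ E₀`. [folklore] -/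
theorem three_le_E₀_UA : 3 ≤ Skelφ.Prm.E₀ (SUA ex mx κ Φ t p D g f q) ∧ 45 * (fcellsA κ Φ t p D g f).rmax ≤ Skelφ.Prm.E₀ (SUA ex mx κ Φ t p D g f q) := by
  have h1 := Skelφ.Prm.planar_le_E₀ (SUA ex mx κ Φ t p D g f q)
  have h2 := (SUA_rmax_ge κ Φ t p D g f ex mx q).1
  have h3 : 1 ≤ (fcellsA κ Φ t p D g f).rmax := le_trans ((fcellsA κ Φ t p D g f).one_le_r 0) ((fcellsA κ Φ t p D g f).r_le_rmax 0)
  have h4 : 45 * (fcellsA κ Φ t p D g f).rmax ≤ Skelφ.Prm.E₀ (SUA ex mx κ Φ t p D g f q) :=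
    le_trans (le_trans (Nat.mul_le_mul_left 45 h2) (Nat.le_add_right _ _)) h1
  exact ⟨le_trans (le_trans (by norm_num : 3 ≤ 45 * 1) (Nat.mul_le_mul_left 45 h3)) h4, h4⟩

/-- **`hsch`**: `Rex (E g' + 1) + L′ ≤ E (g'+1)` for `E := Erad gap 0 E₀`. [folklore] -/
theorem hsch_UA (g' : ℕ) : Rex κ Φ (mRA κ Φ t p D g f (mx κ Φ t p D g f)) q (Erad (Skelφ.Prm.gap (SUA ex mx κ Φ t p D g f q)) (fun _ => 0) (Skelφ.Prm.E₀ (SUA ex mx κ Φ t p D g f q)) g' + 1) +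
      Skelφ.Prm.Lp (SUA ex mx κ Φ t p D g f q) ≤ Erad (Skelφ.Prm.gap (SUA ex mx κ Φ t p D g f q)) (fun _ => 0) (Skelφ.Prm.E₀ (SUA ex mx κ Φ t p D g f q)) (g' + 1) := by
  have h := Skelφ.Prm.hsch (SUA ex mx κ Φ t p D g f q) g'
  exact le_trans (Nat.add_le_add_right (Nat.le_add_right _ _) _) h

/-- `Rex` at the value is monotone. [folklore] -/
theorem Rex_mono_UA : Monotone (SUA ex mx κ Φ t p D g f q).Rex := Rex_monotone κ Φ _ q

/-- **`hR₁` at the value** (depth `ρ+1`, any centre, either orientation, any `η' ≥ η`, planar diameter `mRA`), consumer's instance. [folklore] -/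
theorem hR₁_UA (hC : Φ.CylSubcritical q) (o : Bool) {η' : ℝ} (hη' : Neg.η κ Φ ≤ η') (c : V) :
    ∀ ρ R', (SUA ex mx κ Φ t p D g f q).Rex ρ ≤ R' → ∀ (Rw : ℕ) (D' A' : Finset V), (∀ d ∈ D', d ∈ graphBall G c Rw) →
      (∀ d ∈ D', ∀ d' ∈ D', oriφ Φ.φ o d - oriφ Φ.φ o d' ∈ box 2 (mRA κ Φ t p D g f (mx κ Φ t p D g f))) → A' ⊆ D' → (∀ a ∈ A', a ∈ graphBall G c (ρ + 1)) →
        (bondPercolation G q).real (excess G c R' D' A') ≤ η' := by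
  have hη'' : @Neg.η κ V (fun a b => Classical.propDecidable (a = b)) _ G _ Φ ≤ η' := by convert hη' using 2
  exact hR₁_at κ Φ (mRA κ Φ t p D g f (mx κ Φ t p D g f)) hC o hη'' c

/-- **`hRex` at the value** (depth `R₀'`), consumer's instance. [folklore] -/
theorem hRex_UA (hC : Φ.CylSubcritical q) (o : Bool) {η' : ℝ} (hη' : Neg.η κ Φ ≤ η') (c : V) :
    ∀ R₀' R₁, (SUA ex mx κ Φ t p D g f q).Rex R₀' ≤ R₁ → ∀ (Rw : ℕ) (D' A' : Finset V), (∀ d ∈ D', d ∈ graphBall G c Rw) →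
      (∀ d ∈ D', ∀ d' ∈ D', oriφ Φ.φ o d - oriφ Φ.φ o d' ∈ box 2 (mRA κ Φ t p D g f (mx κ Φ t p D g f))) → A' ⊆ D' → (∀ a ∈ A', a ∈ graphBall G c R₀') →
        (bondPercolation G q).real (excess G c R₁ D' A') ≤ η' := by
  have hη'' : @Neg.η κ V (fun a b => Classical.propDecidable (a = b)) _ G _ Φ ≤ η' := by convert hη' using 2
  exact hRex_at κ Φ (mRA κ Φ t p D g f (mx κ Φ t p D g f)) hC o hη'' c

/-- `hR₁` at the value with `η' := η`. [folklore] -/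
theorem hR₁_UA_η (hC : Φ.CylSubcritical q) (o : Bool) (c : V) :
    ∀ ρ R', (SUA ex mx κ Φ t p D g f q).Rex ρ ≤ R' → ∀ (Rw : ℕ) (D' A' : Finset V), (∀ d ∈ D', d ∈ graphBall G c Rw) →
      (∀ d ∈ D', ∀ d' ∈ D', oriφ Φ.φ o d - oriφ Φ.φ o d' ∈ box 2 (mRA κ Φ t p D g f (mx κ Φ t p D g f))) → A' ⊆ D' → (∀ a ∈ A', a ∈ graphBall G c (ρ + 1)) →
        (bondPercolation G q).real (excess G c R' D' A') ≤ Neg.η κ Φ :=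
  hR₁_UA κ Φ t p D g f ex mx q hC o le_rfl c

/-- **`E₀ (SUA …) = ex + Rex κ Φ mRA q (2·ψπ) + 69·rmax′ + 4·ψπ + 48`** (`rmax′ := max fcellsA.rmax (cOffA+1)`). [folklore] -/
theorem E₀_SUA_eq : Skelφ.Prm.E₀ (SUA ex mx κ Φ t p D g f q) =
    ex κ Φ t p D g f + Rex κ Φ (mRA κ Φ t p D g f (mx κ Φ t p D g f)) q (2 * ψπ Φ p D) + 69 * max (fcellsA κ Φ t p D g f).rmax (cOffA κ Φ t p D g f + 1) + 4 * ψπ Φ p D + 48 := by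
  show Skelφ.Prm.Lp _ + 45 * max (fcellsA κ Φ t p D g f).rmax (cOffA κ Φ t p D g f + 1) + ψπ Φ p D = _
  unfold Skelφ.Prm.Lp Skelφ.Prm.LA Skelφ.Prm.dL
  show 24 * max (fcellsA κ Φ t p D g f).rmax (cOffA κ Φ t p D g f + 1) + 2 * (0 + ψπ Φ p D) + Rex κ Φ (mRA κ Φ t p D g f (mx κ Φ t p D g f)) q (2 * ψπ Φ p D) +
      (24 * 1 + 8 * 0 + 12) + 0 + ψπ Φ p D + 12 * 1 + 2 * 0 + ex κ Φ t p D g f + 45 * max (fcellsA κ Φ t p D g f).rmax (cOffA κ Φ t p D g f + 1) + ψπ Φ p D = _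
  ring

/-- `L′ (SUA …) = ex + Rex(2ψπ) + 24·rmax′ + 3·ψπ + 48`. [folklore] -/
theorem Lp_SUA_eq : Skelφ.Prm.Lp (SUA ex mx κ Φ t p D g f q) =
    ex κ Φ t p D g f + Rex κ Φ (mRA κ Φ t p D g f (mx κ Φ t p D g f)) q (2 * ψπ Φ p D) + 24 * max (fcellsA κ Φ t p D g f).rmax (cOffA κ Φ t p D g f + 1) + 3 * ψπ Φ p D + 48 := by
  unfold Skelφ.Prm.Lp Skelφ.Prm.LA Skelφ.Prm.dL
  show 24 * max (fcellsA κ Φ t p D g f).rmax (cOffA κ Φ t p D g f + 1) + 2 * (0 + ψπ Φ p D) + Rex κ Φ (mRA κ Φ t p D g f (mx κ Φ t p D g f)) q (2 * ψπ Φ p D) +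
      (24 * 1 + 8 * 0 + 12) + 0 + ψπ Φ p D + 12 * 1 + 2 * 0 + ex κ Φ t p D g f = _
  ring

end Facts

/-! ## §3 The four root radii of the (ζ′) schedule (any fibre block `Sv`) -/

section RootRadii

variable (κ : Consts) {V : Type} [DecidableEq V] [Countable V] {G : SimpleGraph V} [G.LocallyFinite] (Φ : PlanarSkeletonNeg G) (t : V)
  (p : unitInterval) (D : DataN V) (g f : ℕ) (Sv : SSlot) (q : unitInterval)

/-- **`hRQ`** for `schedOfA`: `Rπ + 1 ≤ rQ 0 0`. [folklore] -/
theorem hRQ_RA : Rπ κ Φ t p D g f Sv q + 1 ≤ (schedOfA κ Φ t p D g f (Sv κ Φ t p D g f q)).rQ 0 0 := by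
  rw [Rπ_succ]
  show _ ≤ max (Erad (Skelφ.Prm.gap (Sv κ Φ t p D g f q)) (fun _ => 0) (Skelφ.Prm.E₀ (Sv κ Φ t p D g f q)) (nQ 0 0)) _
  exact le_trans (Skel.E₀_le_Erad _ _ _ _) (le_max_left _ _)

/-- **`hRB`** for `schedOfA`: `Rπ + 1 ≤ rB 0 0 du`. [folklore] -/
theorem hRB_RA (du : MDir) : Rπ κ Φ t p D g f Sv q + 1 ≤ (schedOfA κ Φ t p D g f (Sv κ Φ t p D g f q)).rB 0 0 du := by
  rw [Rπ_succ]
  show _ ≤ Erad (Skelφ.Prm.gap (Sv κ Φ t p D g f q)) (fun _ => 0) (Skelφ.Prm.E₀ (Sv κ Φ t p D g f q)) (nQ 0 (0 + stepVec du))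
  exact Skel.E₀_le_Erad _ _ _ _

/-- **`hRQ′`** for `schedOfA`: `Rπ + 1 ≤ rQ 0 (0 + du)`. [folklore] -/
theorem hRQ'_RA (du : MDir) : Rπ κ Φ t p D g f Sv q + 1 ≤ (schedOfA κ Φ t p D g f (Sv κ Φ t p D g f q)).rQ 0 ((0 : Site 2) + stepVec du) := by
  rw [Rπ_succ]
  show _ ≤ max (Erad (Skelφ.Prm.gap (Sv κ Φ t p D g f q)) (fun _ => 0) (Skelφ.Prm.E₀ (Sv κ Φ t p D g f q)) (nQ 0 ((0 : Site 2) + stepVec du))) _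
  exact le_trans (Skel.E₀_le_Erad _ _ _ _) (le_max_left _ _)

/-- **`hRM`** for `schedOfA`: `Rπ + 1 ≤ rM 0 (0 + du)`. [folklore] -/
theorem hRM_RA (du : MDir) : Rπ κ Φ t p D g f Sv q + 1 ≤ (schedOfA κ Φ t p D g f (Sv κ Φ t p D g f q)).rM 0 ((0 : Site 2) + stepVec du) := by
  rw [Rπ_succ]
  show _ ≤ Frad (Skelφ.Prm.gap (Sv κ Φ t p D g f q)) (fun _ => 0) (Skelφ.Prm.E₀ (Sv κ Φ t p D g f q)) (nQ 0 ((0 : Site 2) + stepVec du)) - Skelφ.Prm.Lp (Sv κ Φ t p D g f q)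
  rw [Skel.nQ_zero_stepVec, BoxProdZ2.Frad_succ, BoxProdZ2.Erad_zero]
  have h := Skelφ.Prm.hgapL (Sv κ Φ t p D g f q) (Skelφ.Prm.E₀ (Sv κ Φ t p D g f q))
  omega

end RootRadii

/-! ## §4 The `Rπ`-inequalities of the root residue at `SUA`, as floors on `ex` -/

section RootSU

variable (κ : Consts) {V : Type} [DecidableEq V] [Countable V] {G : SimpleGraph V} [G.LocallyFinite] (Φ : PlanarSkeletonNeg G) (t : V)
  (p : unitInterval) (D : DataN V) (g f : ℕ) (ex mx : GSlot) (q : unitInterval)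

/-- **`X + 1 ≤ ex → X ≤ Rπ`** at `SUA`. [folklore] -/
theorem ex_le_RπA {X : ℕ} (h : X + 1 ≤ ex κ Φ t p D g f) : X ≤ Rπ κ Φ t p D g f (SUA ex mx) q :=
  le_Rπ_of_reachK κ Φ t p D g f (SUA ex mx) q h

/-- **`hρπ`**: `fatRadius Φ.frame hC D.k ≤ Rπ` at `SUA`. [folklore] -/
theorem fat_le_RπA (hC : Φ.CylSubcritical p) : Skelφ.fatRadius Φ.frame hC D.k ≤ Rπ κ Φ t p D g f (SUA ex mx) q := by
  refine le_Rπ_of κ Φ t p D g f (SUA ex mx) q ?_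
  rw [← ψπ_eq Φ hC D, E₀_SUA_eq]; omega

/-- **`hR₁b/hR₁r`** at `SUA`: `r₀ + 1 ≤ ex → Rex κ Φ mRA q (fatRadius Φ.frame hC D.k) ≤ Rπ − r₀`. [cite: KozmaNitzan2024, §4 Lemma 12 (p. 24)] -/
theorem Rex_fat_le_RπA_sub (hC : Φ.CylSubcritical p) {r₀ : ℕ} (h : r₀ + 1 ≤ ex κ Φ t p D g f) :
    Rex κ Φ (mRA κ Φ t p D g f (mx κ Φ t p D g f)) q (Skelφ.fatRadius Φ.frame hC D.k) ≤ Rπ κ Φ t p D g f (SUA ex mx) q - r₀ := by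
  have h1 : Rex κ Φ (mRA κ Φ t p D g f (mx κ Φ t p D g f)) q (Skelφ.fatRadius Φ.frame hC D.k) ≤ Rex κ Φ (mRA κ Φ t p D g f (mx κ Φ t p D g f)) q (2 * ψπ Φ p D) :=
    Rex_mono κ Φ _ q (by rw [ψπ_eq Φ hC D]; omega)
  have h2 := Rπ_succ κ Φ t p D g f (SUA ex mx) q
  rw [E₀_SUA_eq] at h2
  omega

/-- The same with the schedule's own `Rex` field. [folklore] -/
theorem SRex_fat_le_RπA_sub (hC : Φ.CylSubcritical p) {r₀ : ℕ} (h : r₀ + 1 ≤ ex κ Φ t p D g f) :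
    (SUA ex mx κ Φ t p D g f q).Rex (Skelφ.fatRadius Φ.frame hC D.k) ≤ Rπ κ Φ t p D g f (SUA ex mx) q - r₀ :=
  Rex_fat_le_RπA_sub κ Φ t p D g f ex mx q hC h

end RootSU

end NegB

end PlanarSkeletonNeg

end Summit.CriticalPhenomena.PercolationContinuityZ3.Theorems.Transplant

end
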